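import Summits.BirchSwinnertonDyer.BirchSwinnertonDyer.Theorems.ThetaPartnerAtTwoSignedControlAtTwoCasselsPTModKummer
import HarnessLib

/-!
# Poitou–Tate exactness modulo the Kummer conditions — PER-LEVEL / PER-MODULE form (crux K4, line `eulerchar`, Cassels lane)

Crux K4 `SignedControlAtTwo` (stmt-BirchSwinnertonDyer-20309), width seat `prover-bsd-wall-tp2-p3-w3` g6; sequel of
`…CasselsPTModKummer.lean` answering the lead's steer (bsd-wall STATUS 05:01Z / 06:11Z, lead tp2-p3 g4): «state your assembly
against a per-level family `(inv : LocalInvariants ℚ (2^N))` + its properties (or per-module middle exactness, koly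
`PTAt.selmerComplementAt_canonical_of_middleExact`), not against the all-n `poitouTate_selmerStructure_duality ℚ`, so that a
2-power / per-module delivery of the PT roads closes it».

`exists_mem_kummerOutside_localization_sub_mem` (the all-level file) consumes the named fact through ONE family at ONE level
`p^k` and only through (a) injectivity of `inv_v` at the finite places and (b) Howard's Thm. 2.1.11 inclusion (i) of
`SelmerComplement` AT THE ONE MODULE `E[p^k]`. `exists_mem_kummerOutside_localization_sub_mem_of_selmerComplementAt` takes
exactly these two data as hypotheses (verbatim proof otherwise), so that Milne I 4.10(b) for `E[2^k]` and THE canonical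
invariant maps (delivered per module by the Poitou–Tate lanes and turned into (b) by the tree's
`PTAt.selmerComplementAt_canonical_of_middleExact`, with (a) = `LocalInvariants.canonical_isPerfect`) closes it.

THEOREMS ONLY (no definition, no named fact, no `sorry`); BSD is not proved by any of this.

References: [GreenbergLNM1716] §4 Appendix, Prop. 4.13 and p. 121–122; [MilneADT2006] I Thm. 4.10(b), Lemma 6.15;
[Howard2004HeegnerKolyvagin] Thm. 2.1.11.
-/

set_option autoImplicit false
-- the Theorems namespace of this sub repeats the summit name by design (D-0017 nested layout)
set_option linter.dupNamespace false

noncomputable section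

open scoped Classical

open CategoryTheory Field NumberField IsDedekindDomain Function
open Literature.NumberTheory.EllipticCurves Literature.NumberTheory.EllipticCurves.GreenbergSelmer
open Literature.NumberTheory.GaloisRepresentations
open Literature.NumberTheory.GaloisRepresentations.DiscreteGaloisModule (SelmerStructure TateDual
  tateDual localTatePairingZMod unramifiedSubgroup mu MuCarrier)
open Literature.NumberTheory.GaloisCohomology
open scoped ContRepresentation

namespace Summit.BirchSwinnertonDyer.BirchSwinnertonDyer.Theorems.SignedEC.CasselsPT

open Summit.BirchSwinnertonDyer.Rank1Residual.X11b Summit.BirchSwinnertonDyer.Rank1Residual.X11b.KummerPT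
open Summit.BirchSwinnertonDyer.Rank1Residual.X11b.LocBridge
open Summit.BirchSwinnertonDyer.Rank1Residual.X11b.Levels
open Summit.BirchSwinnertonDyer.Rank1Residual.X11b.AcSelmer
open Summit.BirchSwinnertonDyer.Rank1Residual.X11b.FiniteDuality
open Summit.BirchSwinnertonDyer.Rank1Residual.X11b.Relaxation

section ExactnessAt

variable {K : Type} [Field K] [NumberField K] (W : WeierstrassCurve K) [W.IsElliptic] (p k : ℕ)
  [Fact p.Prime]
variable (e : W.geomTorsion ((p ^ k : ℕ) : ℤ) → W.geomTorsion ((p ^ k : ℕ) : ℤ) → AlgebraicClosure K)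
  (hμ : ∀ S T, e S T ^ (p ^ k) = 1)
  (hadd₁ : ∀ S₁ S₂ T, e (S₁ + S₂) T = e S₁ T * e S₂ T)
  (hadd₂ : ∀ S T₁ T₂, e S (T₁ + T₂) = e S T₁ * e S T₂)
  (hgal : ∀ (σ : absoluteGaloisGroup K) (S T : W.geomTorsion ((p ^ k : ℕ) : ℤ)),
    σ • e S T = e (σ • S) (σ • T))
  (halt : ∀ T, e T T = 1) (hnondeg : ∀ T, (∀ S, e S T = 1) → T = 0)

include halt hnondeg in
/-- **POITOU–TATE EXACTNESS MODULO THE KUMMER CONDITIONS, per-level / per-module form.** As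
`exists_mem_kummerOutside_localization_sub_mem`, but the family `inv` at level `p^k` is only assumed (a) injective at the
finite places (`hinj`) and (b) to satisfy Howard's Thm. 2.1.11 inclusion (i) AT THE MODULE `E[p^k]` (`hcomplAt`: for every
admissible `S` and every pair of Selmer structures `𝓕 ≤ 𝓖` on `E[p^k]` unramified outside `S`, a family `t_v ∈ 𝓖_v`
orthogonal to `H¹_{𝓕^*}` is `loc x` modulo `𝓕` for some `x ∈ H¹_𝓖`) — the shape delivered for THE canonical maps by the
tree's `PTAt.selmerComplementAt_canonical_of_middleExact` from Milne I 4.10(b) for `E[p^k]` alone.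
[cite: GreenbergLNM1716, §4 Appendix, Prop. 4.13 and p. 121] [cite: Howard2004HeegnerKolyvagin, Thm. 2.1.11 (arXiv:1202.6340 p. 6)]
[cite: MilneADT2006, Ch. I, Thm. 4.10(b)] -/
theorem exists_mem_kummerOutside_localization_sub_mem_of_selmerComplementAt [Finite (W.geomTorsion ((p ^ k : ℕ) : ℤ))]
    (hk : 0 < k) {inv : LocalInvariants K (p ^ k)}
    (hinj : ∀ v : HeightOneSpectrum (𝓞 K), Injective (inv (Sum.inr v)))
    (hcomplAt : ∀ (S : Finset (Place K)),
      (∀ v : HeightOneSpectrum (𝓞 K), (Sum.inr v : Place K) ∉ S →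
        ((p ^ k : ℕ) : 𝓞 K) ∉ v.asIdeal ∧ GaloisRep.IsUnramifiedAt v (W.torsionGaloisModule ((p ^ k : ℕ) : ℤ))) →
      ∀ (𝓕 𝓖 : SelmerStructure (W.torsionGaloisModule ((p ^ k : ℕ) : ℤ))), 𝓕 ≤ 𝓖 →
        𝓕.IsUnramifiedOutside S → 𝓖.IsUnramifiedOutside S →
        ∀ t : Π v : Place K, galoisCohomology ((W.torsionGaloisModule ((p ^ k : ℕ) : ℤ)).toLocal v) 1,
          (∀ v ∈ S, t v ∈ 𝓖 v) →
          (∀ y ∈ (inv.dualSelmerStructure (W.torsionGaloisModule ((p ^ k : ℕ) : ℤ)) 𝓕).selmerGroup,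
            ∑ v ∈ S, localTatePairingZMod (W.torsionGaloisModule ((p ^ k : ℕ) : ℤ)) (p ^ k) v (inv v) (t v)
              (galoisCohomology.localization ((W.torsionGaloisModule ((p ^ k : ℕ) : ℤ)).tateDual (p ^ k)) v 1 y) = 0) →
          ∃ x ∈ 𝓖.selmerGroup, ∀ v ∈ S,
            galoisCohomology.localization (W.torsionGaloisModule ((p ^ k : ℕ) : ℤ)) v 1 x - t v ∈ 𝓕 v)
    (S' : Finset (Place K))
    (t : Π v : Place K, galoisCohomology ((W.torsionGaloisModule ((p ^ k : ℕ) : ℤ)).toLocal v) 1)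
    (ht : ∀ c : galoisCohomology (W.torsionGaloisModule ((p ^ k : ℕ) : ℤ)) 1,
      (∀ v : HeightOneSpectrum (𝓞 K),
        galoisCohomology.localization (W.torsionGaloisModule ((p ^ k : ℕ) : ℤ)) (Sum.inr v) 1 c ∈
          W.kummerSelmerStructure ((p ^ k : ℕ) : ℤ) (Sum.inr v)) →
      (∀ w : InfinitePlace K, Injective (inv (Sum.inl w)) →
        galoisCohomology.localization (W.torsionGaloisModule ((p ^ k : ℕ) : ℤ)) (Sum.inl w) 1 c ∈
          W.kummerSelmerStructure ((p ^ k : ℕ) : ℤ) (Sum.inl w)) →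
      ∑ v ∈ S', invWeilPairing W (p ^ k) e hμ hadd₁ hadd₂ hgal inv v (t v)
        (galoisCohomology.localization (W.torsionGaloisModule ((p ^ k : ℕ) : ℤ)) v 1 c) = 0) :
    ∃ x ∈ kummerOutside W (p ^ k) S', ∀ v ∈ S',
      galoisCohomology.localization (W.torsionGaloisModule ((p ^ k : ℕ) : ℤ)) v 1 x - t v ∈
        W.kummerSelmerStructure ((p ^ k : ℕ) : ℤ) v := by
  classical
  have hprime : p.Prime := Fact.out
  haveI : NeZero (p ^ k) := ⟨pow_ne_zero k hprime.ne_zero⟩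
  haveI : CompactSpace (absoluteGaloisGroup K) := absoluteGaloisGroup_compactSpace K
  have hpp : IsPrimePow (p ^ k) := ⟨p, k, hprime.prime, hk, rfl⟩
  have hEuler : ∀ v : HeightOneSpectrum (𝓞 K),
      Nat.card (galoisCohomology ((W.torsionGaloisModule ((p ^ k : ℕ) : ℤ)).toLocal (Sum.inr v)) 1) =
        (Nat.card (nsmulAddMonoidHom (p ^ k) :
            (W.baseChange (v.adicCompletion K)).toAffine.Point →+ _).ker *
          Nat.card (v.adicCompletionIntegers K ⧸
            Ideal.span {((p ^ k : ℕ) : v.adicCompletionIntegers K)})) ^ 2 := fun v ↦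
    natCard_galoisCohomology_one_torsion_adicCompletion_eq_sqEP W v (p ^ k) hpp
  obtain ⟨T, hS'T, hinf, hp, hbad⟩ := exists_exceptional_finset W p S'
  have hTout : ∀ v : HeightOneSpectrum (𝓞 K), (Sum.inr v : Place K) ∉ T →
      ((p ^ k : ℕ) : 𝓞 K) ∉ v.asIdeal ∧
        GaloisRep.IsUnramifiedAt v (W.torsionGaloisModule ((p ^ k : ℕ) : ℤ)) := by
    intro v hv
    have hpv : ((p : ℕ) : 𝓞 K) ∉ v.asIdeal := fun h ↦ hv (hp v h)
    have hgood : W.HasGoodReductionAt v := by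
      by_contra hbad'
      exact hv (hbad v hbad')
    exact ⟨natCast_pow_not_mem p hpv _,
      isUnramifiedAt_torsionGaloisModule W hgood (intCast_pow_not_mem p hpv _)⟩
  -- the test family, extended by zero off `S'`
  set t' : Π v : Place K, galoisCohomology ((W.torsionGaloisModule ((p ^ k : ℕ) : ℤ)).toLocal v) 1 :=
    fun v ↦ if v ∈ S' then t v else 0 with ht'def
  have ht'mem : ∀ v ∈ S', t' v = t v := fun v hv ↦ by rw [ht'def]; exact if_pos hv
  have ht'not : ∀ v ∉ S', t' v = 0 := fun v hv ↦ by rw [ht'def]; exact if_neg hv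
  have ht' : ∀ v ∈ T, t' v ∈ kummerRelaxed W (p ^ k) S' v := by
    intro v _
    by_cases hv : v ∈ S'
    · rw [kummerRelaxed_of_mem W (p ^ k) S' hv]; exact AddSubgroup.mem_top _
    · rw [ht'not v hv]; exact zero_mem _
  -- Howard 2.1.11 (i) AT `E[p^k]` for `kummerStrict ∅ ≤ kummerRelaxed S'`
  obtain ⟨x, hx, hxt⟩ := hcomplAt T hTout
    (kummerStrict W (p ^ k) ∅) (kummerRelaxed W (p ^ k) S') (kummerStrict_empty_le_kummerRelaxed W (p ^ k) S')
    (kummerStrict_isUnramifiedOutside W p k ∅ T (Finset.empty_subset T) hinf hp hbad)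
    (kummerRelaxed_isUnramifiedOutside W p k S' T hS'T hinf hp hbad) t' ht' (fun y hy ↦ by
      -- the obstruction vanishes
      set yW := galoisCohomology.map (weilDualInv W (p ^ k) e hμ hadd₁ hadd₂ hgal hnondeg) 1 y
        with hyWdef
      have hyW : galoisCohomology.map (weilDualIntertwining W (p ^ k) e hμ hadd₁ hadd₂ hgal) 1 yW = y :=
        map_weilDual_map_weilDualInv W (p ^ k) e hμ hadd₁ hadd₂ hgal hnondeg y
      have hySel := map_weilDualInv_mem_kummer_of_mem_dualSelmerGroup_kummer W (p ^ k) e hμ hadd₁ hadd₂ hgal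
        halt hnondeg inv hinj hEuler hy
      have hterm : ∀ v : Place K,
          localTatePairingZMod (W.torsionGaloisModule ((p ^ k : ℕ) : ℤ)) (p ^ k) v (inv v) (t' v)
            (galoisCohomology.localization
              ((W.torsionGaloisModule ((p ^ k : ℕ) : ℤ)).tateDual (p ^ k)) v 1 y) =
          invWeilPairing W (p ^ k) e hμ hadd₁ hadd₂ hgal inv v (t' v)
            (galoisCohomology.localization (W.torsionGaloisModule ((p ^ k : ℕ) : ℤ)) v 1 yW) := by
        intro v
        rw [← hyW, localization_map_one, localTatePairingZMod_map_weilDual, invWeilPairing_apply]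
      calc ∑ v ∈ T, localTatePairingZMod (W.torsionGaloisModule ((p ^ k : ℕ) : ℤ)) (p ^ k) v (inv v)
              (t' v) (galoisCohomology.localization
                ((W.torsionGaloisModule ((p ^ k : ℕ) : ℤ)).tateDual (p ^ k)) v 1 y)
          = ∑ v ∈ T, invWeilPairing W (p ^ k) e hμ hadd₁ hadd₂ hgal inv v (t' v)
              (galoisCohomology.localization (W.torsionGaloisModule ((p ^ k : ℕ) : ℤ)) v 1 yW) :=
            Finset.sum_congr rfl fun v _ ↦ hterm v
        _ = ∑ v ∈ S', invWeilPairing W (p ^ k) e hμ hadd₁ hadd₂ hgal inv v (t' v)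
              (galoisCohomology.localization (W.torsionGaloisModule ((p ^ k : ℕ) : ℤ)) v 1 yW) := by
            refine (Finset.sum_subset hS'T fun v _ hvS' ↦ ?_).symm
            rw [ht'not v hvS', map_zero, AddMonoidHom.zero_apply]
        _ = ∑ v ∈ S', invWeilPairing W (p ^ k) e hμ hadd₁ hadd₂ hgal inv v (t v)
              (galoisCohomology.localization (W.torsionGaloisModule ((p ^ k : ℕ) : ℤ)) v 1 yW) :=
            Finset.sum_congr rfl fun v hv ↦ by rw [ht'mem v hv]
        _ = 0 := ht yW hySel.1 hySel.2)
  refine ⟨x, ?_, fun v hv ↦ ?_⟩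
  · rw [← selmerGroup_kummerRelaxed W (p ^ k) S']
    exact hx
  · have h := hxt v (hS'T hv)
    rw [kummerStrict_empty_apply, ht'mem v hv] at h
    exact h

end ExactnessAt

end Summit.BirchSwinnertonDyer.BirchSwinnertonDyer.Theorems.SignedEC.CasselsPT

end
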